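import Mathlib
import Summits.Ventures.HodgeRepro.Tier4.Target
import Summits.Ventures.HodgeRepro.Tier4.Line3.KMDatum
import Summits.Ventures.HodgeRepro.Tier4.Line3.KMDatumS
import Summits.Ventures.HodgeRepro.Tier4.Line3.Defs
import Summits.Ventures.HodgeRepro.Tier4.Line3.HeckeEquivarianceLemmas

/-!
# Tier4/Line3/ClassRegrouping — the main orbit regrouped by `Γ′`-classes (L3.6a, step R2)

Blind re-derivation cell `pub-hodge-repro`, Tier 4 «PROVE THE STEP» (README §9–§10), LINE L3, seat t4-L3-p1 (prover);
support (S4b) of L3.6a `term_main_unfold` (lead S12253): the skeleton's step (R2) — «regroup the absolutely convergent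
series over the main orbit by classes».

CONTENT.  `classStep K` (one `Γ′`-step on line tuples) refines the orbit relation (`orbitStepL_of_classStep`: `Γ′ ⊆ U(H)`),
so the orbit is constant on `Γ′`-classes (`orbitOf_eq_of_classOf_eq`, by `Quot.eqvGen_exact`).  Hence the main orbit
`{w // orbitOf w = orbitOf (lines xm)}` is in bijection with the disjoint union of the classes of the main orbit
(`orbitClassEquiv : {w // …} ≃ Σ c : MainClass K xm, {w // classOf K w = c.1}`), and an absolutely convergent sum over
the main orbit regroups as a double sum over the classes (`tsum_mainOrbit_eq_tsum_mainClass`, Mathlib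
`Summable.tsum_sigma` + `Equiv.tsum_eq`).

Nothing here asserts anything about the truth of (P); HC_CM is NOT proved by anyone in this repository.
-/

set_option autoImplicit false

noncomputable section

namespace Summit.Ventures.HodgeRepro.Tier4.Line3

open Summit.Ventures.HodgeRepro.Tier4
open Matrix
open HeckeEquivariance

namespace T4Data

variable (X : T4Data)

/-- A `Γ′`-step on line tuples is a step of the orbit relation (`Γ′ ⊆ U(H)`). -/
theorem orbitStepL_of_classStep (K : X.Level) {w w' : X.LineTuple} (h : X.classStep K w w') :
    X.orbitStepL w w' := by
  obtain ⟨γ, hγ, rfl⟩ := h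
  exact ⟨γ, isUnitaryOf_of_mem_level X K hγ, fun j => rfl⟩

/-- The orbit is constant along `Γ′`-steps. -/
theorem orbitOf_eq_of_classStep (K : X.Level) {w w' : X.LineTuple} (h : X.classStep K w w') :
    X.orbitOf w = X.orbitOf w' :=
  Quot.sound (X.orbitStepL_of_classStep K h)

/-- The orbit is constant along chains of `Γ′`-steps. -/
theorem orbitOf_eq_of_eqvGen (K : X.Level) {w w' : X.LineTuple} (h : Relation.EqvGen (X.classStep K) w w') :
    X.orbitOf w = X.orbitOf w' := by
  induction h with
  | rel _ _ h => exact X.orbitOf_eq_of_classStep K h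
  | refl _ => rfl
  | symm _ _ _ ih => exact ih.symm
  | trans _ _ _ _ _ ih₁ ih₂ => exact ih₁.trans ih₂

/-- Line tuples in one `Γ′`-class lie in one orbit. -/
theorem orbitOf_eq_of_classOf_eq (K : X.Level) {w w' : X.LineTuple} (h : X.classOf K w = X.classOf K w') :
    X.orbitOf w = X.orbitOf w' :=
  X.orbitOf_eq_of_eqvGen K (Quot.eqvGen_exact h)

/-- The chosen representative of the class of `w` lies in the orbit of `w`. -/
theorem orbitOf_out_classOf (K : X.Level) (w : X.LineTuple) :
    X.orbitOf (Quot.out (X.classOf K w)) = X.orbitOf w :=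
  X.orbitOf_eq_of_classOf_eq K (Quot.out_eq _)

/-- The `Γ′`-class of a line tuple of the main orbit, as a main class. -/
def mainClassOf (K : X.Level) (xm : X.Tuple)
    (w : {w : X.LineTuple // X.orbitOf w = X.orbitOf (X.lines xm)}) : X.MainClass K xm :=
  ⟨X.classOf K w.1, by rw [X.orbitOf_out_classOf]; exact w.2⟩

/-- **THE MAIN ORBIT IS THE DISJOINT UNION OF ITS `Γ′`-CLASSES.** -/
def orbitClassEquiv (K : X.Level) (xm : X.Tuple) :
    {w : X.LineTuple // X.orbitOf w = X.orbitOf (X.lines xm)} ≃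
      Σ c : X.MainClass K xm, {w : X.LineTuple // X.classOf K w = c.1} where
  toFun w := ⟨X.mainClassOf K xm w, ⟨w.1, rfl⟩⟩
  invFun p := ⟨p.2.1, by rw [← X.orbitOf_out_classOf K p.2.1, p.2.2]; exact p.1.2⟩
  left_inv w := rfl
  right_inv := by
    rintro ⟨⟨c, hc⟩, ⟨w, hw⟩⟩
    change X.classOf K w = c at hw
    subst hw
    rfl

/-- **REGROUPING BY CLASSES**: an absolutely convergent sum over the main orbit is the double sum over the classes of
the main orbit. -/
theorem tsum_mainOrbit_eq_tsum_mainClass (K : X.Level) (xm : X.Tuple) (f : X.LineTuple → ℂ)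
    (hf : Summable fun w : {w : X.LineTuple // X.orbitOf w = X.orbitOf (X.lines xm)} => f w.1) :
    ∑' w : {w : X.LineTuple // X.orbitOf w = X.orbitOf (X.lines xm)}, f w.1 =
      ∑' c : X.MainClass K xm, ∑' w : {w : X.LineTuple // X.classOf K w = c.1}, f w.1 := by
  set e := X.orbitClassEquiv K xm with he
  have h1 : (∑' w : {w : X.LineTuple // X.orbitOf w = X.orbitOf (X.lines xm)}, f w.1) =
      ∑' p : Σ c : X.MainClass K xm, {w : X.LineTuple // X.classOf K w = c.1}, f (e.symm p).1 :=
    (e.symm.tsum_eq (fun w => f w.1)).symm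
  have hs : Summable fun p : Σ c : X.MainClass K xm, {w : X.LineTuple // X.classOf K w = c.1} =>
      f (e.symm p).1 := (e.symm.summable_iff).mpr hf
  rw [h1, hs.tsum_sigma]
  rfl

/-- The summability on the main orbit, from the absolute summability over all line tuples. -/
theorem summable_mainOrbit_of_norm (xm : X.Tuple) {f : X.LineTuple → ℂ} (hf : Summable fun w => ‖f w‖) :
    Summable fun w : {w : X.LineTuple // X.orbitOf w = X.orbitOf (X.lines xm)} => f w.1 :=
  (Summable.of_norm hf).subtype _

end T4Data

end Summit.Ventures.HodgeRepro.Tier4.Line3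

end
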